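import Literature.Analysis.FluidPDE.NSQuasipotential
import HarnessLib

/-!
# Guard tightness for line `bead_census` (G1♯ `FlarePersistence`) — refuter lane, crux stmt-NavierStokesRegularity-24077

Line `Cruxes/TypeIQuantSubcubicExp/Lines/bead_census.lean` (v1.2) defines, in the sup-rate Type-I frame of the crux
`QuarterLogPincer.TypeIQuantSubcubicExp`, the level scales `s_k = t₁ e^{-2ak}`, the trace shells
`4M√s_k < ‖x − x₀‖ < e^{a}√s_k`, the predicate `GoodLevel` (a BP-regular annulus `{R < ‖x−x₀‖ < M^{10μ}R}` with
`4M√s_k ≤ R`, `M^{10μ}R ≤ e^{a}√s_k`) and the conjectural stub `FlarePersistenceAt M μ a c` (a BAD level leaves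
`≥ c` of cube trace in its own shell at time `t₁`), guarded in `FlarePersistence` by `∃ a₀, ∀ a ≥ a₀`.
The line's workfile is not importable from `Theorems/`; the four definitions are restated VERBATIM below (same
names, this file's namespace), so identity with a future port is `Iff.rfl`.

Kernel-checked facts (typed audit v6 add2 of ns-afl-r1, evidence on the crux item):
* `not_goodLevel_of_lt_log` — for `0 < M`, `0 < t₁` and `a < log (4 M^{1+10μ})` NO level is good, for ANY field
  (the radius range is empty);
* `flarePersistenceAt_false_of_lt_log` — hence `FlarePersistenceAt M μ a c` is FALSE for every `c > 0` below that
  separation, witnessed by the rest state `u ≡ 0` (frame `T = τ = 1`, `A = 2`, `t₁ = 1`, level 1): the guard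
  `a₀ ≥ log (4 M^{1+10μ})` is NECESSARY;
* `goodLevel_zero_of_log_le` — and SHARP for the rest state: at `a ≥ log (4 M^{1+10μ})` every level of `u ≡ 0` is good;
* `not_goodLevel_of_commonBand` — every candidate annulus contains the COMMON BAND
  `(e^{a}√s_k / M^{10μ}, 4M^{1+10μ}√s_k)`: one threshold violation there, at one window time, makes the level bad
  (at the card's pre-registered `a₀ = log (8M^{1+10μ})` the band is `(8M√s_k, 4M^{1+10μ}√s_k)`).
Honest label: elementary; nothing here asserts or refutes 24077 or any Theses statement; no summit statement is
proved by this file. [folklore]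
-/

-- the summit and its single sub-problem share the name (CONVENTIONS §1), as in every Theorems file
set_option linter.dupNamespace false

namespace Summit.NavierStokesRegularity.NavierStokesRegularity.Theorems.TypeIQuantSubcubicExp.Negative.BeadCensus

noncomputable section

open MeasureTheory Set Metric Function
open Literature.Analysis Literature.Analysis.FluidPDE
open scoped ENNReal NNReal

/-- VERBATIM from the line: parabolic scale of level `k` below `t₁`. -/
def levelScale (a t₁ : ℝ) (k : ℕ) : ℝ := t₁ * Real.exp (-2 * a * k)

/-- VERBATIM from the line: the level-`k` trace shell about `x₀`. -/
def levelShell (M a t₁ : ℝ) (x₀ : (EuclideanSpace ℝ (Fin 3))) (k : ℕ) : Set (EuclideanSpace ℝ (Fin 3)) :=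
  {x | 4 * M * Real.sqrt (levelScale a t₁ k) < ‖x - x₀‖ ∧
    ‖x - x₀‖ < Real.exp a * Real.sqrt (levelScale a t₁ k)}

/-- VERBATIM from the line: a BP-regular annulus at level `k`. -/
def GoodLevel (M μ a : ℝ) (u : ℝ → (EuclideanSpace ℝ (Fin 3)) → (EuclideanSpace ℝ (Fin 3))) (t₁ : ℝ) (x₀ : (EuclideanSpace ℝ (Fin 3))) (k : ℕ) : Prop :=
  ∃ R : ℝ, 4 * M * Real.sqrt (levelScale a t₁ k) ≤ R ∧
    M ^ (10 * μ) * R ≤ Real.exp a * Real.sqrt (levelScale a t₁ k) ∧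
    ∀ t ∈ Icc (t₁ - levelScale a t₁ k / 32) t₁, ∀ x : (EuclideanSpace ℝ (Fin 3)),
      R < ‖x - x₀‖ → ‖x - x₀‖ < M ^ (10 * μ) * R →
      ∀ j : ℕ, j ≤ 2 →
        ‖iteratedFDeriv ℝ j (u t) x‖ ≤ M ^ (-(3 * μ)) * (levelScale a t₁ k) ^ (-(((j : ℝ) + 1) / 2))

/-- VERBATIM from the line (v1.2): flare persistence at `(M, μ, a)` with deposit `c`. -/
def FlarePersistenceAt (M μ a c : ℝ) : Prop :=
  ∀ (T τ A t₁ : ℝ) (x₀ : (EuclideanSpace ℝ (Fin 3))) (u : ℝ → (EuclideanSpace ℝ (Fin 3)) → (EuclideanSpace ℝ (Fin 3))) (p : ℝ → (EuclideanSpace ℝ (Fin 3)) → ℝ) (k : ℕ),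
    (IsClassicalNSSolutionOn (Icc 0 T) 1 0 u p ∧
        ∀ m : ℕ, ∃ C : NNReal, ∀ t ∈ Icc 0 T, eLpNorm (iteratedFDeriv ℝ m (u t)) 2 volume ≤ C) →
      0 < τ →
      (∀ t ∈ Icc 0 T, ∀ x : (EuclideanSpace ℝ (Fin 3)), ‖u t x‖ ≤ M * (T + τ - t) ^ (-(1 / 2 : ℝ))) →
      (∀ t ∈ Icc 0 T, eLpNorm (u t) 3 volume ≤ ENNReal.ofReal A) → 2 ≤ A →
      t₁ ∈ Ioc 0 T → ¬ GoodLevel M μ a u t₁ x₀ (k + 1) →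
      ENNReal.ofReal c ≤ ∫⁻ x in levelShell M a t₁ x₀ (k + 1), ‖u t₁ x‖ₑ ^ (3 : ℝ)

/-- Level scales are positive below a positive evaluation time. -/
theorem levelScale_pos {t₁ : ℝ} (ht₁ : 0 < t₁) (a : ℝ) (k : ℕ) : 0 < levelScale a t₁ k :=
  mul_pos ht₁ (Real.exp_pos _)

/-- `M^{1+10μ} = M · M^{10μ}` for `0 < M`. -/
theorem rpow_split {M : ℝ} (hM : 0 < M) (μ : ℝ) : M ^ (1 + 10 * μ) = M * M ^ (10 * μ) := by
  rw [Real.rpow_add hM, Real.rpow_one]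

/-- **Empty radius range.** For `0 < M`, `0 < t₁` and `a < log (4M^{1+10μ})` no level is good, whatever the field:
`4M√s ≤ R` forces `M^{10μ}R ≥ 4M^{1+10μ}√s > e^{a}√s`. -/
theorem not_goodLevel_of_lt_log {M μ a t₁ : ℝ} (hM : 0 < M) (ha : a < Real.log (4 * M ^ (1 + 10 * μ)))
    (ht₁ : 0 < t₁) (u : ℝ → (EuclideanSpace ℝ (Fin 3)) → (EuclideanSpace ℝ (Fin 3))) (x₀ : (EuclideanSpace ℝ (Fin 3))) (k : ℕ) : ¬ GoodLevel M μ a u t₁ x₀ k := by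
  rintro ⟨R, hR1, hR2, -⟩
  have hs : 0 < Real.sqrt (levelScale a t₁ k) := Real.sqrt_pos.2 (levelScale_pos ht₁ a k)
  have hMp : 0 < M ^ (10 * μ) := Real.rpow_pos_of_pos hM _
  have h4 : 0 < 4 * M ^ (1 + 10 * μ) := by positivity
  have hexp : Real.exp a < 4 * M ^ (1 + 10 * μ) := by
    calc Real.exp a < Real.exp (Real.log (4 * M ^ (1 + 10 * μ))) := Real.exp_lt_exp.2 ha
      _ = 4 * M ^ (1 + 10 * μ) := Real.exp_log h4
  have h1 : M ^ (10 * μ) * (4 * M * Real.sqrt (levelScale a t₁ k)) ≤ M ^ (10 * μ) * R :=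
    mul_le_mul_of_nonneg_left hR1 hMp.le
  have h2 : Real.exp a * Real.sqrt (levelScale a t₁ k)
      < 4 * M ^ (1 + 10 * μ) * Real.sqrt (levelScale a t₁ k) := mul_lt_mul_of_pos_right hexp hs
  rw [rpow_split hM] at h2
  have e : M ^ (10 * μ) * (4 * M * Real.sqrt (levelScale a t₁ k))
      = 4 * (M * M ^ (10 * μ)) * Real.sqrt (levelScale a t₁ k) := by ring
  rw [e] at h1
  linarith

/-- **GUARD TIGHTNESS.** Below `a = log (4M^{1+10μ})` flare persistence fails for every deposit `c > 0`: the rest state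
`u ≡ 0` (frame `T = τ = 1`, `A = 2`, evaluation time `t₁ = 1`, level `1`) has a bad level with zero shell trace. -/
theorem flarePersistenceAt_false_of_lt_log {M μ a c : ℝ} (hM : 0 < M) (ha : a < Real.log (4 * M ^ (1 + 10 * μ)))
    (hc : 0 < c) : ¬ FlarePersistenceAt M μ a c := by
  intro h
  have hframe : IsClassicalNSSolutionOn (Icc (0 : ℝ) 1) 1 0 (0 : ℝ → (EuclideanSpace ℝ (Fin 3)) → (EuclideanSpace ℝ (Fin 3))) 0 ∧
      ∀ m : ℕ, ∃ C : NNReal, ∀ t ∈ Icc (0 : ℝ) 1,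
        eLpNorm (iteratedFDeriv ℝ m ((0 : ℝ → (EuclideanSpace ℝ (Fin 3)) → (EuclideanSpace ℝ (Fin 3))) t)) 2 volume ≤ C := by
    refine ⟨isClassicalNSSolutionOn_zero (Icc (0 : ℝ) 1) 1, fun m => ⟨0, fun t _ => ?_⟩⟩
    simp
  have hrate : ∀ t ∈ Icc (0 : ℝ) 1, ∀ x : (EuclideanSpace ℝ (Fin 3)),
      ‖(0 : ℝ → (EuclideanSpace ℝ (Fin 3)) → (EuclideanSpace ℝ (Fin 3))) t x‖ ≤ M * (1 + 1 - t) ^ (-(1 / 2 : ℝ)) := by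
    intro t ht x
    rw [Pi.zero_apply, Pi.zero_apply, norm_zero]
    exact mul_nonneg hM.le (Real.rpow_nonneg (by linarith [ht.2]) _)
  have hL3 : ∀ t ∈ Icc (0 : ℝ) 1, eLpNorm ((0 : ℝ → (EuclideanSpace ℝ (Fin 3)) → (EuclideanSpace ℝ (Fin 3))) t) 3 volume ≤ ENNReal.ofReal 2 := by
    intro t _
    rw [Pi.zero_apply, eLpNorm_zero]
    exact bot_le
  have hbad := not_goodLevel_of_lt_log (μ := μ) hM ha one_pos (0 : ℝ → (EuclideanSpace ℝ (Fin 3)) → (EuclideanSpace ℝ (Fin 3))) (0 : (EuclideanSpace ℝ (Fin 3))) (0 + 1)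
  have key := h 1 1 2 1 0 0 0 0 hframe one_pos hrate hL3 le_rfl ⟨one_pos, le_rfl⟩ hbad
  have hzero : ∫⁻ x in levelShell M a 1 0 (0 + 1), ‖(0 : ℝ → (EuclideanSpace ℝ (Fin 3)) → (EuclideanSpace ℝ (Fin 3))) 1 x‖ₑ ^ (3 : ℝ) = 0 := by
    have h3 : (0 : ℝ) < 3 := by norm_num
    simp [ENNReal.zero_rpow_of_pos h3]
  rw [hzero] at key
  have h0 : ENNReal.ofReal c = 0 := nonpos_iff_eq_zero.mp key
  rw [ENNReal.ofReal_eq_zero] at h0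
  linarith

/-- **Sharpness for the rest state.** At `a ≥ log (4M^{1+10μ})` (and `0 < M`, `0 < t₁`) every level of `u ≡ 0` is good:
`R = 4M√s_k` is admissible and all derivative bounds hold trivially. -/
theorem goodLevel_zero_of_log_le {M μ a t₁ : ℝ} (hM : 0 < M) (ha : Real.log (4 * M ^ (1 + 10 * μ)) ≤ a)
    (ht₁ : 0 < t₁) (x₀ : (EuclideanSpace ℝ (Fin 3))) (k : ℕ) : GoodLevel M μ a (0 : ℝ → (EuclideanSpace ℝ (Fin 3)) → (EuclideanSpace ℝ (Fin 3))) t₁ x₀ k := by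
  refine ⟨4 * M * Real.sqrt (levelScale a t₁ k), le_rfl, ?_, ?_⟩
  · have hs : 0 ≤ Real.sqrt (levelScale a t₁ k) := Real.sqrt_nonneg _
    have h4 : 0 < 4 * M ^ (1 + 10 * μ) := by positivity
    have hexp : 4 * M ^ (1 + 10 * μ) ≤ Real.exp a := by
      calc 4 * M ^ (1 + 10 * μ) = Real.exp (Real.log (4 * M ^ (1 + 10 * μ))) := (Real.exp_log h4).symm
        _ ≤ Real.exp a := Real.exp_le_exp.2 ha
    have e : M ^ (10 * μ) * (4 * M * Real.sqrt (levelScale a t₁ k))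
        = 4 * M ^ (1 + 10 * μ) * Real.sqrt (levelScale a t₁ k) := by
      rw [rpow_split hM]; ring
    rw [e]
    exact mul_le_mul_of_nonneg_right hexp hs
  · intro t _ x _ _ j _
    have h0 : iteratedFDeriv ℝ j ((0 : ℝ → (EuclideanSpace ℝ (Fin 3)) → (EuclideanSpace ℝ (Fin 3))) t) x = 0 := by
      simp
    rw [h0, norm_zero]
    exact mul_nonneg (Real.rpow_nonneg hM.le _) (Real.rpow_nonneg (levelScale_pos ht₁ a k).le _)

/-- **The common band.** Every candidate annulus `{R < ‖x−x₀‖ < M^{10μ}R}` with `4M√s_k ≤ R`, `M^{10μ}R ≤ e^{a}√s_k`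
contains the band `(e^{a}√s_k / M^{10μ}, 4M^{1+10μ}√s_k)`; so a single threshold violation in that band at one window
time makes the level bad. -/
theorem not_goodLevel_of_commonBand {M μ a t₁ : ℝ} {u : ℝ → (EuclideanSpace ℝ (Fin 3)) → (EuclideanSpace ℝ (Fin 3))} {x₀ : (EuclideanSpace ℝ (Fin 3))} {k : ℕ} (hM : 0 < M)
    (hviol : ∃ t ∈ Icc (t₁ - levelScale a t₁ k / 32) t₁, ∃ x : (EuclideanSpace ℝ (Fin 3)),
      Real.exp a * Real.sqrt (levelScale a t₁ k) / M ^ (10 * μ) < ‖x - x₀‖ ∧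
      ‖x - x₀‖ < 4 * M ^ (1 + 10 * μ) * Real.sqrt (levelScale a t₁ k) ∧
      ∃ j : ℕ, j ≤ 2 ∧
        M ^ (-(3 * μ)) * (levelScale a t₁ k) ^ (-(((j : ℝ) + 1) / 2)) < ‖iteratedFDeriv ℝ j (u t) x‖) :
    ¬ GoodLevel M μ a u t₁ x₀ k := by
  rintro ⟨R, hR1, hR2, hreg⟩
  obtain ⟨t, ht, x, hx1, hx2, j, hj, hlt⟩ := hviol
  have hMp : 0 < M ^ (10 * μ) := Real.rpow_pos_of_pos hM _
  have hRx : R < ‖x - x₀‖ := by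
    have hR : R ≤ Real.exp a * Real.sqrt (levelScale a t₁ k) / M ^ (10 * μ) := by
      rw [le_div_iff₀ hMp]
      linarith [hR2]
    exact lt_of_le_of_lt hR hx1
  have hxR : ‖x - x₀‖ < M ^ (10 * μ) * R := by
    have h1 : M ^ (10 * μ) * (4 * M * Real.sqrt (levelScale a t₁ k)) ≤ M ^ (10 * μ) * R :=
      mul_le_mul_of_nonneg_left hR1 hMp.le
    have e : M ^ (10 * μ) * (4 * M * Real.sqrt (levelScale a t₁ k))
        = 4 * M ^ (1 + 10 * μ) * Real.sqrt (levelScale a t₁ k) := by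
      rw [rpow_split hM]; ring
    rw [e] at h1
    exact lt_of_lt_of_le hx2 h1
  exact absurd (hreg t ht x hRx hxR j hj) (not_le.2 hlt)

end

end Summit.NavierStokesRegularity.NavierStokesRegularity.Theorems.TypeIQuantSubcubicExp.Negative.BeadCensus
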